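import Mathlib
import Summits.MatrixMultiplication.MatrixMultiplication.Theorems.SnSubsetDichotomyHyperoctahedralThresholdStubCycleGadget
import Summits.MatrixMultiplication.MatrixMultiplication.Theorems.SnSubsetDichotomyHyperoctahedralThresholdStubPathGadget
import Summits.MatrixMultiplication.MatrixMultiplication.Theorems.SnSubsetDichotomyHyperoctahedralThresholdStubMobiusGadget
import Summits.MatrixMultiplication.MatrixMultiplication.Theorems.SnSubsetDichotomyHyperoctahedralThresholdStubExtract
import Summits.MatrixMultiplication.MatrixMultiplication.Theorems.SnSubsetDichotomyHyperoctahedralThresholdStubPackGadgets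
import Summits.MatrixMultiplication.MatrixMultiplication.Theorems.SnSubsetDichotomyHyperoctahedralThresholdStubGoodTwin
import Summits.MatrixMultiplication.MatrixMultiplication.Theorems.SnSubsetDichotomyHyperoctahedralThresholdStubBadCount
import Summits.MatrixMultiplication.MatrixMultiplication.Theorems.SnSubsetDichotomyHyperoctahedralThresholdStubPatternTwin
import Summits.MatrixMultiplication.MatrixMultiplication.Theorems.SnSubsetDichotomyHyperoctahedralThresholdCleanPairFinal
import Summits.MatrixMultiplication.MatrixMultiplication.Theorems.SnSubsetDichotomyHyperoctahedralThresholdPoorOfRigid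
import Summits.MatrixMultiplication.MatrixMultiplication.Theorems.SnSubsetDichotomyHyperoctahedralThresholdRefutationCore
import Summits.MatrixMultiplication.MatrixMultiplication.Theorems.HyperoctahedralThreshold.Negative.HyperoctahedralThresholdFalseOfLocalTriplePacking
import Summits.MatrixMultiplication.MatrixMultiplication.Theses.SnSubsetDichotomy

/-!
# Crux `SnSubsetDichotomy.HyperoctahedralSubsets` (stmt-MatrixMultiplication-8305) — PROVED, via the matching lemma (L′)

THE KNIFE EDGE FOR SUBSETS: there are `c > 0` and `n₀` such that for `n ≥ n₀`, any three fixed-point-free involutions `μ_i` of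
`Fin n` (perfect matchings `M_i`) and subsets `X_i ⊆ C(μ_i) = B(M_i) ≅ S_2 ≀ S_{n/2}` with the triple product property satisfy
`|X₀||X₁||X₂| ≤ (n!)^{3/2} e^{−c√n}` — `hyperoctahedralSubsets_proof` (bottom of the file).

Proof = line `spherical-rank-sieve` (leads prover-line-stmt-MatrixMultiplication-8305-0 … -c7).  GROUP PACKING: a TPP triple hosted by
the three matching centralisers has volume `≤ |B|³/|T|` for every subgroup `T ≤ C(μ₀) × C(μ₁) × C(μ₂)` of product-one triples
(`stub_groupPacking` p74548); `g` support-disjoint commuting local triples give `|T| ≥ 2^g` (`stub_triplesToGroup` p79923); pairs with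
short alternating cycles are handled by pairwise packing inside the hosts (`stub_pairwisePacking` p75305, `stub_cycleCount` p76793,
`stub_hostSquare` p75879).  That composition is the tree theorem `hyperoctahedralSubsets_of_localTriplePacking` (p118938), conditional
on the matching lemma (L′) `…HyperoctahedralThreshold.Negative.LocalTriplePacking`: there are `c > 0` and `n₀` such that every triple
of fixed-point-free involutions of `Fin n`, `n ≥ n₀`, admits `≥ c√n` commuting local triples with pairwise disjoint supports.

(L′) is PROVED here — `HyperoctahedralSubsets.localTriplePacking_holds`, with `c = 1/4` — by assembling the landed stubs of the
refutation line `refutation-local-symmetry` of the twin crux `HyperoctahedralThreshold` (stmt-MatrixMultiplication-10883, skeleton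
`Cruxes/HyperoctahedralThreshold/Lines/refutation_local_symmetry.lean`, whose last open stub `stub_poorRigidCore` landed as p131375):

* `poorCore` — second peel: `stub_patternTwin` (p107640) + `stub_poorRigidCore` (p131375) give the poor core;
* `richDescent` / `cleanWalk` — the halving descent on rich words (`stub_goodTwin` p99339, `stub_badCount` p98890) removes the
  poorness hypothesis: ONE closed rung walk with pairwise equal-or-disjoint rungs, `≤ n^{1/4}` of them, avoiding any `|R| ≤ n^{3/4}`;
* `oneGadget` — extraction (`stub_extract` p90186) and the gadget zoo (`stub_cycleGadget` p88731, `stub_pathGadget` p88744,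
  `stub_mobiusGadget` p90070) turn the walk into one commuting local triple supported on `≤ 2n^{1/4}` points outside `R`;
* `localTriplePacking_holds` — greedy packing (`PackGadgets.greedy_pack`, p88618) of `⌈√n/4⌉` such gadgets.

The glue is the 10883 skeleton's (leads prover-line-stmt-MatrixMultiplication-10883-0, -c1, -c2), made hypothesis-free.
-/

-- the project's summit namespace repeats a component by design (D-0022)
set_option linter.dupNamespace false

namespace Summit.MatrixMultiplication.MatrixMultiplication.Theorems.HyperoctahedralSubsets

namespace LocalTriplePackingProof

/-- **The poor core** (skeleton `stub_poorCore`, second peel `poorCore_of` of lead 10883-c2): if some short word has a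
large pattern class, `stub_patternTwin` (p107640) supplies the clean walk directly; otherwise the rigidity hypothesis of
`stub_poorRigidCore` (p131375) holds. [this line] -/
theorem poorCore :
  ∃ n₀ : ℕ, ∀ n ≥ n₀, ∀ μ : Fin 3 → Equiv.Perm (Fin n), (∀ i, μ i * μ i = 1 ∧ ∀ v, μ i v ≠ v) → ∀ R : Finset (Fin n), (R.card : ℝ) ≤ (n : ℝ) ^ ((3 : ℝ) / 4) → (∀ z : List (Fin 3), z ≠ [] → List.IsChain (· ≠ ·) (z ++ z) → (z.length : ℝ) ≤ (n : ℝ) ^ ((1 : ℝ) / 4) → ∀ (m : ℕ) (x : Fin m → Fin n), Function.Injective x → (∀ i, z.foldl (fun v c => μ c v) (x i) = x i) → m ≤ (4 * z.length ^ 2) ^ (Nat.log 2 z.length + 1) * (R.card + 1)) → ∃ (k : ℕ) (p q : Fin (k + 1) → Fin n) (col : Fin (k + 1) → Fin 3), (∀ i, p i ≠ q i) ∧ (∀ i, (μ (col i) (p i) = p (i + 1) ∧ μ (col i) (q i) = q (i + 1)) ∨ (μ (col i) (p i) = q (i + 1) ∧ μ (col i) (q i) = p (i + 1))) ∧ (∀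 i, col i ≠ col (i + 1)) ∧ (∀ i j, (p i = p j ∧ q i = q j) ∨ (p i = q j ∧ q i = p j) ∨ (p i ≠ p j ∧ p i ≠ q j ∧ q i ≠ p j ∧ q i ≠ q j)) ∧ (∀ i, p i ∉ R ∧ q i ∉ R) ∧ ((k : ℝ) + 1) ≤ (n : ℝ) ^ ((1 : ℝ) / 4) := by
  obtain ⟨n₀, hC⟩ := Summit.MatrixMultiplication.MatrixMultiplication.Theorems.HyperoctahedralThreshold.stub_poorRigidCore
  refine ⟨n₀, fun n hn μ hμ R hR hpoor => ?_⟩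
  by_cases hrig : ∀ z : List (Fin 3), z ≠ [] → List.IsChain (· ≠ ·) (z ++ z) → (z.length : ℝ) ≤ (n : ℝ) ^ ((1 : ℝ) / 4) → ∀ (m : ℕ) (x : Fin m → Fin n), Function.Injective x → (∀ i, z.foldl (fun v c => μ c v) (x i) = x i) → (∀ i j, ∀ s t : Fin z.length, ((z.take (s : ℕ)).foldl (fun v c => μ c v) (x i) = (z.take (t : ℕ)).foldl (fun v c => μ c v) (x i) ↔ (z.take (s : ℕ)).foldl (fun v c => μ c v) (x j) = (z.take (t : ℕ)).foldl (fun v c => μ c v) (x j))) → m ≤ 2 * (z.length * R.card) + z.length ^ 2 + 1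
  · exact hC n hn μ hμ R hR hpoor hrig
  · push Not at hrig
    obtain ⟨z, hz0, hzc, hzlen, m, x, hx, hfix, hpat, hm⟩ := hrig
    have hz2 : 2 ≤ z.length := Summit.MatrixMultiplication.MatrixMultiplication.Theorems.HyperoctahedralThreshold.PoorOfRigid.two_le_length_of_isChain hz0 hzc
    obtain ⟨k, p, q, col, h1, h2, h3, h4, h5, hk⟩ :=
      Summit.MatrixMultiplication.MatrixMultiplication.Theorems.HyperoctahedralThreshold.stub_patternTwin n μ R z m x (fun c => (hμ c).1) hz2 hzc hx hfix hpat (by omega)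
    refine ⟨k, p, q, col, h1, h2, h3, h4, h5, ?_⟩
    have : ((k : ℝ) + 1) = (z.length : ℝ) := by exact_mod_cast hk
    rw [this]; exact hzlen

/-- **`richDescent`** (halving descent on rich words).  For fixed-point-free involutions, a cyclically reduced word `z` of length `ℓ`
with MORE than `A ℓ |R| = (4ℓ²)^(⌊log₂ ℓ⌋+1)·(|R|+1)` distinct fixed points yields clean-cycle data (Stub 1 format) avoiding `R` with at
most `ℓ` rungs: either `≥ ℓ|R| + ℓ² + 2` of the fixed points are good (`stub_goodTwin`, p99339), or the bad ones are too many for every short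
cyclically reduced word to be poor (`stub_badCount`, p98890, with `M := A(ℓ/2)`), so a word of at most half the length is rich — induct.
(Skeleton glue of lead 10883-c1, hypotheses discharged by the tree theorems.) [this line] -/
theorem richDescent {n : ℕ} (μ : Fin 3 → Equiv.Perm (Fin n))
    (hμ : ∀ i, μ i * μ i = 1 ∧ ∀ v, μ i v ≠ v) (R : Finset (Fin n)) (ℓ : ℕ) :
    ∀ (z : List (Fin 3)), z.length = ℓ → z ≠ [] → List.IsChain (· ≠ ·) (z ++ z) →
    ∀ (m : ℕ) (x : Fin m → Fin n), Function.Injective x → (∀ i, z.foldl (fun v c => μ c v) (x i) = x i) →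
    (4 * ℓ ^ 2) ^ (Nat.log 2 ℓ + 1) * (R.card + 1) < m →
    ∃ (k : ℕ) (p q : Fin (k + 2) → Fin n) (col : Fin (k + 2) → Fin 3), Function.Injective p ∧ Function.Injective q ∧
      (∀ i j, p i ≠ q j) ∧ (∀ i, μ (col i) (p i) = p (i + 1) ∧ μ (col i) (q i) = q (i + 1)) ∧
      (∀ i, col i ≠ col (i + 1)) ∧ (∀ i, p i ∉ R ∧ q i ∉ R) ∧ k + 2 ≤ ℓ := by
  induction ℓ using Nat.strong_induction_on with
  | _ ℓ ih =>
  intro z hzl hz0 hzc m x hx hfix hrich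
  classical
  have hinv : ∀ c, μ c * μ c = 1 := fun c => (hμ c).1
  have hfpf : ∀ c v, μ c v ≠ v := fun c v => (hμ c).2 v
  have hz2 : 2 ≤ z.length := Summit.MatrixMultiplication.MatrixMultiplication.Theorems.HyperoctahedralThreshold.PoorOfRigid.two_le_length_of_isChain hz0 hzc
  have hℓ2 : 2 ≤ ℓ := hzl ▸ hz2
  -- good and bad fixed points
  let good : Finset (Fin m) := Finset.univ.filter
    (fun i => Function.Injective (fun t : Fin z.length => (z.take (t : ℕ)).foldl (fun v c => μ c v) (x i)))
  let bad : Finset (Fin m) := Finset.univ.filter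
    (fun i => ¬ Function.Injective (fun t : Fin z.length => (z.take (t : ℕ)).foldl (fun v c => μ c v) (x i)))
  have hsplit : good.card + bad.card = m := by
    have := Finset.card_filter_add_card_filter_not (s := (Finset.univ : Finset (Fin m)))
      (fun i => Function.Injective (fun t : Fin z.length => (z.take (t : ℕ)).foldl (fun v c => μ c v) (x i)))
    simpa using this
  by_cases hg : ℓ * R.card + ℓ ^ 2 + 2 ≤ good.card
  · -- enough good fixed points: Stub 3b
    let e := (Finset.equivFin good).symm
    let x' : Fin good.card → Fin n := fun j => x (e j).1
    have hx' : Function.Injective x' := by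
      intro j j' h
      exact e.injective (Subtype.ext (hx h))
    have hfix' : ∀ j, z.foldl (fun v c => μ c v) (x' j) = x' j := fun j => hfix _
    have hinj' : ∀ j, Function.Injective (fun t : Fin z.length => (z.take (t : ℕ)).foldl (fun v c => μ c v) (x' j)) :=
      fun j => (Finset.mem_filter.1 (e j).2).2
    have hgz : z.length * R.card + z.length ^ 2 + 2 ≤ good.card := by rw [hzl]; exact hg
    obtain ⟨k, p, q, col, h1, h2, h3, h4, h5, h6, h7⟩ :=
      Summit.MatrixMultiplication.MatrixMultiplication.Theorems.HyperoctahedralThreshold.stub_goodTwin n μ R z good.card x' hinv hz2 hzc hx' hfix' hinj' hgz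
    exact ⟨k, p, q, col, h1, h2, h3, h4, h5, h6, by omega⟩
  · push Not at hg
    set M₀ : ℕ := (4 * (ℓ / 2) ^ 2) ^ (Nat.log 2 (ℓ / 2) + 1) * (R.card + 1) with hM₀
    by_cases hpoor : ∀ τ : List (Fin 3), τ ≠ [] → 2 * τ.length ≤ z.length → List.IsChain (· ≠ ·) (τ ++ τ) →
        ∀ (m' : ℕ) (y : Fin m' → Fin n), Function.Injective y → (∀ i, τ.foldl (fun v c => μ c v) (y i) = y i) →
          m' ≤ M₀
    · -- every short word poor: Stub 3c bounds the bad fixed points, contradiction with richness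
      exfalso
      let e := (Finset.equivFin bad).symm
      let x' : Fin bad.card → Fin n := fun j => x (e j).1
      have hx' : Function.Injective x' := by
        intro j j' h
        exact e.injective (Subtype.ext (hx h))
      have hfix' : ∀ j, z.foldl (fun v c => μ c v) (x' j) = x' j := fun j => hfix _
      have hninj' : ∀ j, ¬ Function.Injective
          (fun t : Fin z.length => (z.take (t : ℕ)).foldl (fun v c => μ c v) (x' j)) :=
        fun j => (Finset.mem_filter.1 (e j).2).2
      have hbad : bad.card ≤ z.length.choose 2 * M₀ :=
        Summit.MatrixMultiplication.MatrixMultiplication.Theorems.HyperoctahedralThreshold.stub_badCount n μ z M₀ bad.card x' hinv hfpf hz2 hzc hpoor hx' hfix' hninj'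
      rw [hzl] at hbad
      have hstep := Summit.MatrixMultiplication.MatrixMultiplication.Theorems.HyperoctahedralThreshold.Refutation.thresholdA_step hℓ2 R.card
      rw [← hM₀] at hstep
      omega
    · -- a short rich word: induct
      push Not at hpoor
      obtain ⟨τ, hτ0, hτlen, hτc, m', y, hy, hyfix, hrich'⟩ := hpoor
      have hτ2 : 2 ≤ τ.length := Summit.MatrixMultiplication.MatrixMultiplication.Theorems.HyperoctahedralThreshold.PoorOfRigid.two_le_length_of_isChain hτ0 hτc
      have hτlt : τ.length < ℓ := by omega
      have hτhalf : τ.length ≤ ℓ / 2 := by omega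
      have hthr : (4 * τ.length ^ 2) ^ (Nat.log 2 τ.length + 1) * (R.card + 1) < m' :=
        lt_of_le_of_lt (Summit.MatrixMultiplication.MatrixMultiplication.Theorems.HyperoctahedralThreshold.PoorOfRigid.thresholdA_mono hτhalf R.card) hrich'
      obtain ⟨k, p, q, col, h1, h2, h3, h4, h5, h6, h7⟩ := ih τ.length hτlt τ rfl hτ0 hτc m' y hy hyfix hthr
      exact ⟨k, p, q, col, h1, h2, h3, h4, h5, h6, by omega⟩

/-- **One clean walk** (skeleton `stub_cleanWalk`, glue `cleanWalk_of` of lead 10883-c1): for large `n`, three fixed-point-free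
involutions and a forbidden set `R` with `|R| ≤ n^{3/4}` admit a closed colour-walk of the rung graph with pairwise equal-or-disjoint
rungs, `≤ n^{1/4}` of them, avoiding `R` — by cases on poorness: the poor case is `poorCore`, and a rich word yields a clean twin cycle
by `richDescent`, re-packaged as such a walk. [this line] -/
theorem cleanWalk :
  ∃ n₀ : ℕ, ∀ n ≥ n₀, ∀ μ : Fin 3 → Equiv.Perm (Fin n), (∀ i, μ i * μ i = 1 ∧ ∀ v, μ i v ≠ v) → ∀ R : Finset (Fin n), (R.card : ℝ) ≤ (n : ℝ) ^ ((3 : ℝ) / 4) → ∃ (k : ℕ) (p q : Fin (k + 1) → Fin n) (col : Fin (k + 1) → Fin 3), (∀ i, p i ≠ q i) ∧ (∀ i, (μ (col i) (p i) = p (i + 1) ∧ μ (col i) (q i) = q (i + 1)) ∨ (μ (col i) (p i) = q (i + 1) ∧ μ (col i) (q i) = p (i + 1))) ∧ (∀ i, col i ≠ col (i + 1)) ∧ (∀ i j, (p i = p j ∧ q i = q j) ∨ (p i = q j ∧ q i = p j) ∨ (p i ≠ p j ∧ p i ≠ q j ∧ q i ≠ p j ∧ q i ≠ q j)) ∧ (∀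 i, p i ∉ R ∧ q i ∉ R) ∧ ((k : ℝ) + 1) ≤ (n : ℝ) ^ ((1 : ℝ) / 4) := by
  obtain ⟨n₀, hC⟩ := poorCore
  refine ⟨n₀, fun n hn μ hμ R hR => ?_⟩
  by_cases hpoor : ∀ z : List (Fin 3), z ≠ [] → List.IsChain (· ≠ ·) (z ++ z) → (z.length : ℝ) ≤ (n : ℝ) ^ ((1 : ℝ) / 4) →
      ∀ (m : ℕ) (x : Fin m → Fin n), Function.Injective x → (∀ i, z.foldl (fun v c => μ c v) (x i) = x i) →
        m ≤ (4 * z.length ^ 2) ^ (Nat.log 2 z.length + 1) * (R.card + 1)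
  · exact hC n hn μ hμ R hR hpoor
  · push Not at hpoor
    obtain ⟨z, hz0, hzc, hzlen, m, x, hx, hfix, hrich⟩ := hpoor
    obtain ⟨k, p, q, col, hp, hq, hpq, hstep, hcol, havoid, hk⟩ :=
      richDescent μ hμ R z.length z rfl hz0 hzc m x hx hfix hrich
    refine ⟨k + 1, p, q, col, fun i => hpq i i, fun i => Or.inl (hstep i), hcol, ?_, havoid, ?_⟩
    · intro i j
      by_cases hij : i = j
      · subst hij; exact Or.inl ⟨rfl, rfl⟩
      · exact Or.inr (Or.inr ⟨fun h => hij (hp h), hpq i j, fun h => hpq j i h.symm, fun h => hij (hq h)⟩)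
    · have e : ((k + 1 : ℕ) : ℝ) + 1 = ((k + 2 : ℕ) : ℝ) := by push_cast; ring
      rw [e]
      exact le_trans (by exact_mod_cast hk) hzlen

/-- **One gadget** (skeleton `OneGadget`, glue `oneGadget_of`): for large `n`, every forbidden set of size `≤ n^{3/4}` is avoided by
the support `P` of some commuting local triple, `|P| ≤ 2 n^{1/4}` — the clean walk of `cleanWalk` is cut by `stub_extract` (p90186) into
clean cycle / path / Möbius data, which `stub_cycleGadget` (p88731), `stub_pathGadget` (p88744), `stub_mobiusGadget` (p90070) turn into a
local triple supported on the walk's points. [this line] -/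
theorem oneGadget :
  ∃ n₀ : ℕ, ∀ n ≥ n₀, ∀ μ : Fin 3 → Equiv.Perm (Fin n), (∀ i, μ i * μ i = 1 ∧ ∀ v, μ i v ≠ v) → ∀ R : Finset (Fin n), (R.card : ℝ) ≤ (n : ℝ) ^ ((3 : ℝ) / 4) → ∃ (a b : Equiv.Perm (Fin n)) (P : Finset (Fin n)), (a * a = 1 ∧ b * b = 1 ∧ a * b = b * a ∧ (a ≠ 1 ∨ b ≠ 1) ∧ a * μ 0 = μ 0 * a ∧ b * μ 1 = μ 1 * b ∧ a * b * μ 2 = μ 2 * (a * b) ∧ ∀ v, (a v ≠ v ∨ b v ≠ v) → v ∈ P) ∧ Disjoint P R ∧ (P.card : ℝ) ≤ 2 * (n : ℝ) ^ ((1 : ℝ) / 4) := by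
  obtain ⟨n₀, hW⟩ := cleanWalk
  refine ⟨n₀, fun n hn μ hμ R hR => ?_⟩
  have hinv : ∀ c, μ c * μ c = 1 := fun c => (hμ c).1
  obtain ⟨k, p, q, col, hpq, hstep, hcol, heod, havoid, hsmall⟩ := hW n hn μ hμ R hR
  -- the support set: all points of the walk
  have hdisj : Disjoint (Finset.univ.image p ∪ Finset.univ.image q) R := by
    rw [Finset.disjoint_left]
    intro v hv hvR
    simp only [Finset.mem_union, Finset.mem_image, Finset.mem_univ, true_and] at hv
    rcases hv with ⟨i, rfl⟩ | ⟨i, rfl⟩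
    · exact (havoid i).1 hvR
    · exact (havoid i).2 hvR
  have hcard : ((Finset.univ.image p ∪ Finset.univ.image q).card : ℝ) ≤ 2 * (n : ℝ) ^ ((1 : ℝ) / 4) := by
    refine (Summit.MatrixMultiplication.MatrixMultiplication.Theorems.HyperoctahedralThreshold.Refutation.card_image_union_le p q).trans ?_
    push_cast
    linarith
  have hfpf : ∀ c v, μ c v ≠ v := fun c v => (hμ c).2 v
  rcases Summit.MatrixMultiplication.MatrixMultiplication.Theorems.HyperoctahedralThreshold.stub_extract n k μ p q col hinv hfpf hpq hstep hcol heod with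
    ⟨k', p', q', col', hp, hq, hpq', hstep', hcol', hamong, -⟩ |
    ⟨k', p', q', col', hp, hq, hpq', h0, hlast, hstep', hcol', hamong, -⟩ |
    ⟨k', p', q', col', hp, hq, hpq', hstep', hwp, hwq, hcol', hwrap, hamong, -⟩
  · obtain ⟨a, b, h1, h2, h3, h4, h5, h6, h7, hsupp⟩ :=
      Summit.MatrixMultiplication.MatrixMultiplication.Theorems.HyperoctahedralThreshold.stub_cycleGadget n k' μ p' q' col' hinv hp hq hpq' hstep' hcol'
    exact ⟨a, b, _, ⟨h1, h2, h3, h4, h5, h6, h7, fun v hv =>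
        Summit.MatrixMultiplication.MatrixMultiplication.Theorems.HyperoctahedralThreshold.Refutation.mem_image_union_of_among p q p' q' hamong v (hsupp v hv)⟩,
      hdisj, hcard⟩
  · obtain ⟨a, b, h1, h2, h3, h4, h5, h6, h7, hsupp⟩ :=
      Summit.MatrixMultiplication.MatrixMultiplication.Theorems.HyperoctahedralThreshold.stub_pathGadget n k' μ p' q' col' hinv hp hq hpq' h0 hlast hstep' hcol'
    exact ⟨a, b, _, ⟨h1, h2, h3, h4, h5, h6, h7, fun v hv =>
        Summit.MatrixMultiplication.MatrixMultiplication.Theorems.HyperoctahedralThreshold.Refutation.mem_image_union_of_among p q p' q' hamong v (hsupp v hv)⟩,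
      hdisj, hcard⟩
  · obtain ⟨a, b, h1, h2, h3, h4, h5, h6, h7, hsupp⟩ :=
      Summit.MatrixMultiplication.MatrixMultiplication.Theorems.HyperoctahedralThreshold.stub_mobiusGadget n k' μ p' q' col' hinv hp hq hpq' hstep' hwp hwq hcol' hwrap
    exact ⟨a, b, _, ⟨h1, h2, h3, h4, h5, h6, h7, fun v hv =>
        Summit.MatrixMultiplication.MatrixMultiplication.Theorems.HyperoctahedralThreshold.Refutation.mem_image_union_of_among p q p' q' hamong v (hsupp v hv)⟩,
      hdisj, hcard⟩
end LocalTriplePackingProof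

/-- **(L′) — `LocalTriplePacking` holds** (with `c = 1/4`): greedy packing of the gadgets of `LocalTriplePackingProof.oneGadget`
(`PackGadgets.greedy_pack`, p88618: the union of the supports placed so far is the next forbidden set, of size
`≤ (⌈√n/4⌉ − 1)·2n^{1/4} ≤ n^{3/4}`); disjointness of a new support from the earlier ones is the pairwise-fixing clause.
This discharges the hypothesis of `hyperoctahedralSubsets_of_localTriplePacking` /
`hyperoctahedralThreshold_false_of_localTriplePacking` (p118938). [this line] -/
theorem localTriplePacking_holds :
    Summit.MatrixMultiplication.MatrixMultiplication.Theorems.HyperoctahedralThreshold.Negative.LocalTriplePacking := by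
  obtain ⟨n₀, hG⟩ := LocalTriplePackingProof.oneGadget
  refine ⟨1 / 4, by norm_num, n₀, ?_⟩
  intro n hn μ hμ
  -- greedy packing of `⌈√n / 4⌉₊` gadgets `(a, b, P)` with pairwise disjoint support sets `P`
  obtain ⟨F, hgood, -, hdisj⟩ := HyperoctahedralThreshold.PackGadgets.greedy_pack
    (fun t : Equiv.Perm (Fin n) × Equiv.Perm (Fin n) × Finset (Fin n) =>
      t.1 * t.1 = 1 ∧ t.2.1 * t.2.1 = 1 ∧ t.1 * t.2.1 = t.2.1 * t.1 ∧ (t.1 ≠ 1 ∨ t.2.1 ≠ 1) ∧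
        t.1 * μ 0 = μ 0 * t.1 ∧ t.2.1 * μ 1 = μ 1 * t.2.1 ∧
        t.1 * t.2.1 * μ 2 = μ 2 * (t.1 * t.2.1) ∧ ∀ v, (t.1 v ≠ v ∨ t.2.1 v ≠ v) → v ∈ t.2.2)
    (fun t => t.2.2) (mul_nonneg zero_le_two (Real.rpow_nonneg (Nat.cast_nonneg n) _))
    (fun R hR => by
      obtain ⟨a, b, P, h1, h2, h3⟩ := hG n hn μ hμ R hR
      exact ⟨(a, b, P), h1, h2, h3⟩)
    ⌈Real.sqrt n / 4⌉₊ (HyperoctahedralThreshold.PackGadgets.ceil_sub_one_mul_le n)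
  refine ⟨⌈Real.sqrt n / 4⌉₊, fun j => (F j).1, fun j => (F j).2.1,
    HyperoctahedralThreshold.PackGadgets.quarter_mul_sqrt_le_ceil n, fun j => ?_, fun j j' hjj' v hv => ?_⟩
  · obtain ⟨h1, h2, h3, h4, h5, h6, h7, -⟩ := hgood j
    exact ⟨h1, h2, h3, h4, h5, h6, h7⟩
  · -- `v` is moved by gadget `j`, so `v ∈ P j`, so `v ∉ P j'`, so gadget `j'` fixes `v`
    have hvj : v ∈ (F j).2.2 := (hgood j).2.2.2.2.2.2.2 v hv
    have hvj' : v ∉ (F j').2.2 := Finset.disjoint_left.1 (hdisj j j' hjj') hvj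
    by_contra hcon
    exact hvj' ((hgood j').2.2.2.2.2.2.2 v (not_and_or.1 hcon))

end Summit.MatrixMultiplication.MatrixMultiplication.Theorems.HyperoctahedralSubsets

namespace Summit.MatrixMultiplication.MatrixMultiplication.Theorems

/-- **`HyperoctahedralSubsets` holds** (crux stmt-MatrixMultiplication-8305 of route `SnSubsetDichotomy`): TPP triples of subsets of
three matching centralisers `C(μ_i) ≤ S_n` have volume `≤ (n!)^{3/2} e^{-c√n}` for some `c > 0` and all large `n`.  By the conditional
closing theorem `hyperoctahedralSubsets_of_localTriplePacking` (group packing over a product-one triple group of order `2^{√n/4}`) and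
the matching lemma `localTriplePacking_holds`. [this line] -/
theorem hyperoctahedralSubsets_proof :
    Summit.MatrixMultiplication.MatrixMultiplication.Theses.SnSubsetDichotomy.HyperoctahedralSubsets :=
  HyperoctahedralThreshold.Negative.hyperoctahedralSubsets_of_localTriplePacking
    HyperoctahedralSubsets.localTriplePacking_holds

end Summit.MatrixMultiplication.MatrixMultiplication.Theorems
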